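import Summits.BirchSwinnertonDyer.BirchSwinnertonDyer.Theorems.PrintCf2RubinValueTwoColemanCoinvariantCharTraceEllipticUnitsTowerDataOffsetIndex
import Literature.NumberTheory.EllipticCurves.PAdicTwoVariableColemanImageNonvanishingOfMoment
import HarnessLib

/-!
# Brick (c) at `p = 2`, local `χ`-part ON THE `ℤ/d`-TRACE, FOR THE ELLIPTIC UNITS, tower data with the 2-power offset, rational auxiliary
# index — WITH `L_ε ≠ 0` REDUCED TO ONE NON-ZERO GALOIS TRACE OF A COATES–WILES MOMENT OF `e(𝔞₁)`

Cell `bsd-print-cf2`, width seat `bsd-line-cf2c-w7` g18, route C `PrintCf2RubinValueTwo`, crux of record stmt-BirchSwinnertonDyer-24033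
`TwoVariableMainConjAtSplitTwoQuad` (23720 nominal), BRICK §4(c); `--supports` the crux as a helper.  THEOREMS ONLY (0 sorry, no named fact
asserted, no definition); CONDITIONAL on the published named facts `DeShalit1987.prop24_ii/iii`, `prop25_i` carried as hypotheses by the
elliptic-unit files.  Theses-free.  BSD is not proved by any of this.

`…TowerDataOffsetIndex` (this seat, T6) discharged de Shalit's auxiliary index `a₂`; the remaining ANALYTIC hypothesis of the (c)-capstone was
`hL0 : L_ε ≠ 0` — by `ne_zero_iff_colemanDeltaCoinvFun_ne_zero_of_twistMul` the non-vanishing of the two-variable `ε`-projection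
`φ_ε(Σ_j Col β_{a₁} (j)) ∈ 𝒪⟦X⟧⟦T⟧`.  `PAdicTwoVariableColemanImageNonvanishingOfMoment` (this seat) specialises `X ↦ 0` (base change of `φ_ε`,
`LubinTateColemanCoordBaseChangeTwo`), reads the result at level `m` (`LubinTateColemanUnitsImageSpecializationTwo`: the moments of the
specialised trace are the Galois traces of the moments of the level-`m` coordinates) and evaluates at a weight of the right parity:
`φ_ε(Σ_j Col β (j)) ≠ 0` as soon as ONE Galois trace `Σ_τ τ(mom_k(r_{β,m}))` is non-zero.  THIS file plugs it into T6:

* ★★★ `charIdeal_coinvariants_colemanImageTrace_closure_ellipticUnits_towerDataOffset_eq_span_of_moment` — T6 `…_of_eq_pow` with `hL0`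
  replaced by `(mm kk) (hεk : κ_{mm} ε = (−1)^{kk+1}) (hmom : Σ_τ τ(mom_{kk}(r_{β_{a₁},mm})) ≠ 0)`.

What the assembler still supplies: the Coleman frame, theta families (II §2.4 named facts), lifts, `α₁`/`r` per the (A) recipe, the factor
family `g`, the divided element `L` with `hL` (from `exists_…`/`existsUnique_…` upstream), and NOW only: one level/weight with a non-zero
Galois trace of a Coates–Wiles value of `e(𝔞₁)` (II §4.9–4.10: `12(N𝔞₁ − ψ(𝔞₁)^k)Ω^{−k}(1 − ψ(𝔭)^k/N𝔭^{…})L_𝔣(ψ̄^k, k)` up to units).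

## References
* [deShalit1987] E. de Shalit, *Iwasawa theory of elliptic curves with complex multiplication* (1987), II §1.9, §1.10, §2.4 (ii), §4.9–4.10,
  §4.12 (29)–(33), §4.14, §4.17; III §1.3, §1.4 (5), Cor. 1.5, Lemma 1.10 (17).
* [Serre1973CourseArithmetic] J.-P. Serre, *A Course in Arithmetic* (1973), Ch. II §3.1–§3.3.
* [NeukirchANT1999] J. Neukirch, *Algebraic Number Theory* (1999), Ch. VI §5 Prop. (5.6), §7 Thm. (7.1), Cor. (7.3).
-/

noncomputable section

set_option linter.dupNamespace false
set_option autoImplicit false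

open Filter Topology
open scoped PowerSeries.WithPiTopology
open scoped NumberField Classical

namespace Summit.BirchSwinnertonDyer.BirchSwinnertonDyer.Theorems.PrintCf2.ColemanCoinvariantTraceEllipticUnitsTowerDataOffsetMoment

open Field IsDedekindDomain IsDedekindDomain.HeightOneSpectrum ValuativeRel WithZero
open Literature.NumberTheory.NumberFields
open Literature.NumberTheory.GaloisRepresentations Literature.NumberTheory.GaloisRepresentations.IsNonarchimedeanLocalField
  Literature.NumberTheory.GaloisRepresentations.LubinTate Literature.NumberTheory.GaloisRepresentations.ArtinLocalGlobal
open Literature.NumberTheory.EllipticCurves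
open Literature.NumberTheory.ComplexMultiplication.EllipticUnits
open Literature.NumberTheory.LFunctions.AbelianDensity (artinSymbol)
open Literature.RingTheory.PowerSeries (maxEval)
open Summit.BirchSwinnertonDyer.BirchSwinnertonDyer.Theorems.PrintCf2.ColemanImage
open Summit.BirchSwinnertonDyer.BirchSwinnertonDyer.Theorems.PrintCf2.ColemanCoinvariantGalois
open Summit.BirchSwinnertonDyer.BirchSwinnertonDyer.Theorems.PrintCf2.ColemanCoinvariantArtin
open Summit.BirchSwinnertonDyer.BirchSwinnertonDyer.Theorems.PrintCf2.EllipticUnitsLocal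
open Summit.BirchSwinnertonDyer.BirchSwinnertonDyer.Theorems.PrintCf2.EllipticUnitsLocal₂
open Summit.BirchSwinnertonDyer.BirchSwinnertonDyer.Theorems.PrintCf2.ColemanCoinvariantEllipticUnits
open Summit.BirchSwinnertonDyer.BirchSwinnertonDyer.Theorems.PrintCf2.ColemanCoinvariantEllipticUnitsLiftable
open Summit.BirchSwinnertonDyer.BirchSwinnertonDyer.Theorems.PrintCf2.ColemanCoinvariantTrace
open Summit.BirchSwinnertonDyer.BirchSwinnertonDyer.Theorems.PrintCf2.ColemanCoinvariantTraceEllipticUnits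
open Summit.BirchSwinnertonDyer.BirchSwinnertonDyer.Theorems.PrintCf2.ColemanCoinvariantTraceEllipticUnitsTowerDataOffset
open Summit.BirchSwinnertonDyer.BirchSwinnertonDyer.Theorems.PrintCf2.ColemanCoinvariantTraceEllipticUnitsTowerDataOffsetIndex

variable {K : Type} [Field K] [NumberField K] {𝔤₀ : Ideal (𝓞 K)} {v v' : HeightOneSpectrum (𝓞 K)}

attribute [local instance] ltNormUniformSpace ltNormIsUniformAddGroup rk1 nF nE fintypeResidueField
attribute [local instance] RelNormCoherentUnits.instCommMonoid

/-- `v ∤ 𝔤₀v'^ν` for `v ∤ 𝔤₀`, `v ≠ v'`. [cite: deShalit1987, II.4.14 (p. 71)] -/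
private theorem not_mul_pow_le₂₅ (hv : ¬ 𝔤₀ ≤ v.asIdeal) (hvv' : v' ≠ v) (n : ℕ) : ¬ 𝔤₀ * v'.asIdeal ^ n ≤ v.asIdeal := by
  intro h
  rcases (v.isPrime.mul_le).mp h with h1 | h2
  · exact hv h1
  · rcases n with _ | n
    · rw [pow_zero, Ideal.one_eq_top, top_le_iff] at h2
      exact v.isPrime.ne_top h2
    · exact hvv' (HeightOneSpectrum.ext ((v'.isMaximal.eq_of_le v.isPrime.ne_top ((Ideal.IsPrime.pow_le_iff (hP := v.isPrime)
        (Nat.succ_ne_zero n)).mp h2))))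

/-! ## The (c)-identity of S51/T6 with `ha₂` discharged and `hL0` reduced to one moment -/

section Capstone

attribute [local instance] isAdicComplete_maximalIdeal_powerSeries_integer

variable [NumberField.IsTotallyComplex K]
  (h24iii : DeShalit1987.prop24_iii_unit) (h25 : DeShalit1987.prop25_i_normRelation) (h24ii : DeShalit1987.prop24_ii_galoisAction)
  (hK : IsImaginaryQuadratic K) (ιK : K →+* ℂ)
  -- the global data: `𝔤₀`, the auxiliary prime `v'` (degree one, absolutely unramified over `p`), ONE element `α`
  (h𝔤0 : 𝔤₀ ≠ ⊥) (hv : ¬ 𝔤₀ ≤ v.asIdeal) (hv' : ¬ 𝔤₀ ≤ v'.asIdeal) (hvv' : v' ≠ v)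
  (hw𝔤 : ∀ u : (𝓞 K)ˣ, (u : 𝓞 K) - 1 ∈ 𝔤₀ → u = 1)
  {p : ℕ} [hp : Fact p.Prime] (hdeg1 : Nat.card (𝓞 K ⧸ v'.asIdeal) = p) (hpv' : (p : 𝓞 K) ∈ v'.asIdeal) (hpv'2 : (p : 𝓞 K) ∉ v'.asIdeal ^ 2)
  {π : 𝒪[v.adicCompletion K]} (hπ : (valuation (v.adicCompletion K)).IsUniformizer (π : v.adicCompletion K))
  {α : 𝓞 K} (hα0 : α ≠ 0) (hα𝔤 : α - 1 ∈ 𝔤₀) (hαw : ∀ w : HeightOneSpectrum (𝓞 K), w ≠ v → α ∉ w.asIdeal)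
  {f : ℕ} (hαf : Ideal.span {α} = v.asIdeal ^ f) (hαπ : ((α : K) : v.adicCompletion K) = (π : v.adicCompletion K) ^ f)
  {ℓ ν : ℕ} (hℓ : 1 ≤ ℓ) (hαℓ : v'.intValuation (α - 1) = exp (-(ℓ : ℤ)))
  (ha2 : 2 ≤ ν + 1 ∨ p ≠ 2) (hαa : v'.intValuation (α ^ p - 1) = exp (-((ν + 1 : ℕ) : ℤ)))
  [CharZero (v.adicCompletion K)]
  -- the residue degree `f = d₀·p^r` of `v` in `K(𝔤₀)` (2-power part `p^r` INCLUDED) and the local frame of the (c)-chain on the trace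
  {d₀ r : ℕ} (hd : d₀.Coprime p) (hf : f = d₀ * p ^ r) (hfo : f ∣ orderOf (galFrob K (rayClassField K 𝔤₀) v))
  (E : ℕ → IntermediateField (v.adicCompletion K) (AlgebraicClosure (v.adicCompletion K)))
  [∀ j, FiniteDimensional (v.adicCompletion K) (E j)] [∀ j, Normal (v.adicCompletion K) (E j)] [∀ j, IsGalois (v.adicCompletion K) (E j)]
  (hmono : Monotone E) (hE : ∀ j, E j ≤ maxUnramified (v.adicCompletion K)) (hdeg : ∀ j, Module.finrank (v.adicCompletion K) (E j) = d₀ * p ^ j)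
  {σ₀ : absoluteGaloisGroup (v.adicCompletion K)} (hσ₀ : IsAbsArithFrob σ₀) (hq : residueFieldCard (v.adicCompletion K) = 2)
  (u : (LTCoeff (v.adicCompletion K))ˣ) (hu : LTCoeff.of (v.adicCompletion K) π = residueFieldCard (v.adicCompletion K) * u)
  (γ w : 𝒪[v.adicCompletion K]ˣ) (hγ : (γ : 𝒪[v.adicCompletion K]) = 1 + π ^ 2 * w)
  [IsAdicComplete (Ideal.span {intBase (v.adicCompletion K) (LTCoeff.of (v.adicCompletion K) π)}) (PowerSeries 𝒪[v.adicCompletion K])]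
  [NeZero d₀]
  {θ : ∀ j, unitBall (E j)} (hθ : ∀ j, IsIntegralNormalGen (E j) (θ j))
  (hcoh : ∀ j, unitBallTrace (hmono (Nat.le_succ j)) (θ (j + 1)) = θ j)
  [IsAdicComplete (Ideal.span {(p : 𝒪[v.adicCompletion K])}) 𝒪[v.adicCompletion K]]
  (hI : Ideal.span {(p : 𝒪[v.adicCompletion K])} ≠ ⊤)
  (hud : ∀ j, (u : LTCoeff (v.adicCompletion K)) ^ Module.finrank (v.adicCompletion K) (E j) ≠ 1)
  (hm : ∃ m₁ : ℕ, LTCoeff.of (v.adicCompletion K) π ^ 2 ∣ LTCoeff.of (v.adicCompletion K) π - m₁)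
  (hN : DenseRange (Nat.cast : ℕ → 𝒪[v.adicCompletion K]))
  -- theta families and local lifts indexed by the liftable ideals of the tower `𝔤 = 𝔤₀v'^ν`
  (x : ∀ a : {𝔞 : Ideal (𝓞 K) // IsLocArtinLiftable (𝔤₀ * v'.asIdeal ^ ν) v v' 𝔞}, ∀ i k : ℕ,
    rayClassField K (𝔤₀ * v'.asIdeal ^ ν * v'.asIdeal ^ (i + 1) * v.asIdeal ^ (k + 1)))
  (hx : ∀ a, ∀ i k : ℕ, IsThetaValueOne ιK (𝔤₀ * v'.asIdeal ^ ν * v'.asIdeal ^ (i + 1) * v.asIdeal ^ (k + 1)) (a.1 : Ideal (𝓞 K))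
    (algClosureEmb ιK ((x a i k : rayClassField K (𝔤₀ * v'.asIdeal ^ ν * v'.asIdeal ^ (i + 1) * v.asIdeal ^ (k + 1))) : AlgebraicClosure K)))
  (σ : {𝔞 : Ideal (𝓞 K) // IsLocArtinLiftable (𝔤₀ * v'.asIdeal ^ ν) v v' 𝔞} → absoluteGaloisGroup (v.adicCompletion K))
  (hσ : ∀ a, ∀ i k : ℕ, absRestrictNormalHom (rayClassField K (𝔤₀ * v'.asIdeal ^ ν * v'.asIdeal ^ (i + 1) * v.asIdeal ^ (k + 1)))
      (absGaloisRestrict K (v.adicCompletion K) (σ a)) =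
    artinSymbol (galFrob K (rayClassField K (𝔤₀ * v'.asIdeal ^ ν * v'.asIdeal ^ (i + 1) * v.asIdeal ^ (k + 1)))) (a.1 : Ideal (𝓞 K)))
  (ε : PowerSeries (PowerSeries 𝒪[v.adicCompletion K]))
  (g : {𝔞 : Ideal (𝓞 K) // IsLocArtinLiftable (𝔤₀ * v'.asIdeal ^ ν) v v' 𝔞} → (PowerSeries 𝒪[v.adicCompletion K])ˣ)

include h24ii hσ hm hmono hℓ hαℓ hαf hfo in
/-- ★★★ **THE LOCAL (c)-IDENTITY ON THE `ℤ/d`-TRACE WITH BOTH ANALYTIC INPUTS REDUCED TO NUMBERS**: as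
`…towerDataOffset_eq_span_of_eq_pow` (rational auxiliary index `a₂`), and with the hypothesis `hL0 : L_ε ≠ 0` REPLACED by ONE non-zero
Galois trace of a Coates–Wiles MOMENT of the elliptic-unit family `β_{a₁}` at some level `mm` and weight `kk` of the parity of `ε`
(`κ_{mm} ε = (−1)^{kk+1}`): **`Σ_{τ ∈ Gal(E_{mm}/K_v)} τ(mom_{kk}(r_{β_{a₁},mm})) ≠ 0`** (`mom_k(r_β)` = the `k`-th Coates–Wiles value,
`coordMoment_relUnitCoordTwo_eq_coatesWiles`; by II §4.9–4.10 a non-zero multiple of `L(ψ̄^k, k)`).  The discharge is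
`PAdicTwoVariableColemanImageNonvanishingOfMoment` (base change of `φ_ε` along `X ↦ 0` + the moments of the specialised trace) and
`ne_zero_iff_colemanDeltaCoinvFun_ne_zero_of_twistMul`.  Conclusion: **`char_Λ ((N_Σ / Col_Σ 𝒞̄_ell)_ε) = (L_ε)`**.
[cite: deShalit1987, II §1.9, §1.10, §2.4 (ii), §4.12 (29)–(33), §4.14, §4.17; III §1.3, §1.4 (5), Cor. 1.5, Lemma 1.10 (17)]
[cite: Serre1973CourseArithmetic, Ch. II §3.1, §3.2 Thm. 3, §3.3] [cite: NeukirchANT1999, Ch. VI §5 Prop. (5.6), §7 Thm. (7.1)] -/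
theorem charIdeal_coinvariants_colemanImageTrace_closure_ellipticUnits_towerDataOffset_eq_span_of_moment (hε : ε * ε = 1)
    (a₁ a₂ : {𝔞 : Ideal (𝓞 K) // IsLocArtinLiftable (𝔤₀ * v'.asIdeal ^ ν) v v' 𝔞}) (hv₁ : lubinTateChar hπ (σ a₁) = γ)
    (hn₁ : ((Ideal.absNorm (a₁.1 : Ideal (𝓞 K)) : ℕ) : PowerSeries 𝒪[v.adicCompletion K]) * ((g a₁)⁻¹ : (PowerSeries 𝒪[v.adicCompletion K])ˣ) - 1 ∈
      IsLocalRing.maximalIdeal (PowerSeries 𝒪[v.adicCompletion K]))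
    (hg₁ : PowerSeries.constantCoeff (g a₁ : PowerSeries 𝒪[v.adicCompletion K]) = 1)
    (hg₂ : PowerSeries.constantCoeff (g a₂ : PowerSeries 𝒪[v.adicCompletion K]) = 1)
    (hn₁π : π ^ 2 ∣ ((Ideal.absNorm (a₁.1 : Ideal (𝓞 K)) : ℕ) : 𝒪[v.adicCompletion K]) - 1)
    {m : ℕ} (hne : ((Ideal.absNorm (a₁.1 : Ideal (𝓞 K)) : ℕ) : 𝒪[v.adicCompletion K]) ≠ (γ : 𝒪[v.adicCompletion K]) ^ m)
    (hn₂ : ((Ideal.absNorm (a₂.1 : Ideal (𝓞 K)) : ℕ) : 𝒪[v.adicCompletion K]) = (lubinTateChar hπ (σ a₂) : 𝒪[v.adicCompletion K]) ^ m)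
    (hv₂ : lubinTateChar hπ (σ a₂) ≠ 1) (hv₂' : lubinTateChar hπ (σ a₂) ≠ -1)
    (mm kk : ℕ) [IsAdicComplete (Ideal.span {algebraMap (LTCoeff (v.adicCompletion K)) (unitBall (E mm)) (LTCoeff.of (v.adicCompletion K) π)})
      (unitBall (E mm))]
    (hεk : PowerSeries.map ((algebraMap 𝒪[v.adicCompletion K] (unitBall (E mm))).comp
      (PowerSeries.constantCoeff (R := 𝒪[v.adicCompletion K]))) ε = (-1) ^ (kk + 1))
    (hmom : ∑ τ : E mm ≃ₐ[v.adicCompletion K] E mm, unitBallEquiv (E mm) τ (coordMoment hπ (E mm) u kk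
      (relUnitCoordTwo hπ (E mm) hq (hE mm) hσ₀ u hu
        (ellipticUnitsPrincipal₂ h24iii h25 hK ιK
                    (mul_ne_zero h𝔤0 (pow_ne_zero ν v'.ne_bot))
                    (not_mul_pow_le₂₅ hv hvv' ν) hvv'
                    (hw_of_towerData hw𝔤) hπ
                    (towerData_hα0 (p := p) hα0)
                    (towerData_hα𝔪 hv' hp.out hpv' hpv'2 hα𝔤 ha2 hαa)
                    (towerData_hαw (p := p) hαw)
                    (towerData_hαπ (p := p) hαπ) E hmono (r + 1)
                  (fun i ↦ hE (i + (r + 1)))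
                      (towerDataOffset_hdegE hf E hE hdeg) a₁.2.1 a₁.2.2.1 (x a₁) (hx a₁) mm))) ≠ 0)
    (L : PowerSeries (PowerSeries 𝒪[v.adicCompletion K]))
    (hL : ∀ b : {𝔞 : Ideal (𝓞 K) // IsLocArtinLiftable (𝔤₀ * v'.asIdeal ^ ν) v v' 𝔞}, colemanDeltaCoinvFun hπ hq (intBase (v.adicCompletion K)) u hu γ (eq_zero_of_C_pi_mul_eq_zero_integer hπ) w hγ ε
        (indexTraceₗ hπ hq u hu γ (colemanImage hd hπ E hmono hE hdeg hσ₀ hq u hu γ hθ hcoh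
          (closure_unitsGen_subset_principalCoherentFamilies hπ E hmono
            (fun b ↦ ellipticUnitsPrincipal₂ h24iii h25 hK ιK
                (mul_ne_zero h𝔤0 (pow_ne_zero ν v'.ne_bot))
                (not_mul_pow_le₂₅ hv hvv' ν) hvv'
                (hw_of_towerData hw𝔤) hπ
                (towerData_hα0 (p := p) hα0)
                (towerData_hα𝔪 hv' hp.out hpv' hpv'2 hα𝔤 ha2 hαa)
                (towerData_hαw (p := p) hαw)
                (towerData_hαπ (p := p) hαπ) E hmono (r + 1) (fun i ↦ hE (i + (r + 1)))
                (towerDataOffset_hdegE hf E hE hdeg)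
              b.2.1 b.2.2.1 (x b) (hx b))
            (fun b ↦ ellipticUnitsPrincipal₂_mem_principalCoherentFamilies h24iii h25 hK ιK
                (mul_ne_zero h𝔤0 (pow_ne_zero ν v'.ne_bot))
                (not_mul_pow_le₂₅ hv hvv' ν) hvv'
                (hw_of_towerData hw𝔤) hπ
                (towerData_hα0 (p := p) hα0)
                (towerData_hα𝔪 hv' hp.out hpv' hpv'2 hα𝔤 ha2 hαa)
                (towerData_hαw (p := p) hαw)
                (towerData_hαπ (p := p) hαπ) E hmono (r + 1)
              (fun i ↦ hE (i + (r + 1)))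
                  (towerDataOffset_hdegE hf E hE hdeg) b.2.1 b.2.2.1 (fun i ↦
                  (towerDataOffset_hinert h𝔤0 hv hv' hvv' hw𝔤 hp.out hpv' hpv'2 hπ hα0 hα𝔤 hαf hℓ hαℓ ha2 hαa hf hfo E hE hdeg) (i + 1))
                  (towerDataOffset_hcount h𝔤0 hv' hvv' hw𝔤 hp.out hdeg1 hpv' hpv'2 E hdeg) (x b) (hx b))
            (mem_closure_unitsGen hπ E _ b)).1)) =
      (colemanDeltaCoinvFun hπ hq (intBase (v.adicCompletion K)) u hu γ (eq_zero_of_C_pi_mul_eq_zero_integer hπ) w hγ ε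
          (unitTwistₗ hπ hq (intBase (v.adicCompletion K)) u hu γ (lubinTateChar hπ (σ b)) (TActModule.ofPS _ _ 1)) *
          PowerSeries.C (g b : PowerSeries 𝒪[v.adicCompletion K]) - PowerSeries.C ((Ideal.absNorm (b.1 : Ideal (𝓞 K)) : ℕ) : PowerSeries 𝒪[v.adicCompletion K])) * L) :
    Module.charIdeal (PowerSeries (PowerSeries 𝒪[v.adicCompletion K]))
        (↥(unitsImageTrace hd hπ E hmono hE hdeg hσ₀ hq u hu γ hθ hcoh hI hud) ⧸
          colemanCoinvRel hπ hq (intBase (v.adicCompletion K)) u hu γ ε (unitsImageTrace hd hπ E hmono hE hdeg hσ₀ hq u hu γ hθ hcoh hI hud)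
            (fun _ hG => unitTwistₗ_mem_unitsImageTrace hd hπ E hmono hE hdeg hσ₀ hq u hu γ hθ hcoh hI hud (-1) hG)
            (colemanImageTrace hd hπ E hmono hE hdeg hσ₀ hq u hu γ hθ hcoh hN
              (closure (Submonoid.closure
                (Set.range (fun b ↦ ellipticUnitsPrincipal₂ h24iii h25 hK ιK
                    (mul_ne_zero h𝔤0 (pow_ne_zero ν v'.ne_bot))
                    (not_mul_pow_le₂₅ hv hvv' ν) hvv'
                    (hw_of_towerData hw𝔤) hπ
                    (towerData_hα0 (p := p) hα0)
                    (towerData_hα𝔪 hv' hp.out hpv' hpv'2 hα𝔤 ha2 hαa)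
                    (towerData_hαw (p := p) hαw)
                    (towerData_hαπ (p := p) hαπ) E hmono (r + 1) (fun i ↦ hE (i + (r + 1)))
                  (towerDataOffset_hdegE hf E hE hdeg) b.2.1 b.2.2.1 (x b) (hx b)) ∪
                  Set.range fun b ↦ fun j ↦ (ellipticUnitsPrincipal₂ h24iii h25 hK ιK
                      (mul_ne_zero h𝔤0 (pow_ne_zero ν v'.ne_bot))
                      (not_mul_pow_le₂₅ hv hvv' ν) hvv'
                      (hw_of_towerData hw𝔤) hπ
                      (towerData_hα0 (p := p) hα0)
                      (towerData_hα𝔪 hv' hp.out hpv' hpv'2 hα𝔤 ha2 hαa)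
                      (towerData_hαw (p := p) hαw)
                      (towerData_hαπ (p := p) hαπ) E hmono (r + 1)
                    (fun i ↦ hE (i + (r + 1))) (towerDataOffset_hdegE hf E hE hdeg) b.2.1 b.2.2.1 (x b) (hx b) j).inv hπ (E j)) :
                Set (∀ j, RelNormCoherentUnits hπ (E j))))
              isClosed_closure
              (closure_unitsGen_subset_principalCoherentFamilies hπ E hmono _
                (fun b ↦ ellipticUnitsPrincipal₂_mem_principalCoherentFamilies h24iii h25 hK ιK
                    (mul_ne_zero h𝔤0 (pow_ne_zero ν v'.ne_bot))
                    (not_mul_pow_le₂₅ hv hvv' ν) hvv'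
                    (hw_of_towerData hw𝔤) hπ
                    (towerData_hα0 (p := p) hα0)
                    (towerData_hα𝔪 hv' hp.out hpv' hpv'2 hα𝔤 ha2 hαa)
                    (towerData_hαw (p := p) hαw)
                    (towerData_hαπ (p := p) hαπ) E hmono (r + 1)
                  (fun i ↦ hE (i + (r + 1)))
                      (towerDataOffset_hdegE hf E hE hdeg) b.2.1 b.2.2.1 (fun i ↦
                      (towerDataOffset_hinert h𝔤0 hv hv' hvv' hw𝔤 hp.out hpv' hpv'2 hπ hα0 hα𝔤 hαf hℓ hαℓ ha2 hαa hf hfo E hE hdeg) (i + 1))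
                      (towerDataOffset_hcount h𝔤0 hv' hvv' hw𝔤 hp.out hdeg1 hpv' hpv'2 E hdeg) (x b) (hx b)))
              (one_mem_closure_unitsGen hπ E _) (mul_mem_closure_unitsGen hπ E _) (inv_mem_closure_unitsGen hπ E _)
              (galAct_mem_closure_unitsGen hπ E _ (galAct_mem_closure_unitsGen_of_mul_rule hπ E hmono _ σ
                (happrox_of_isLocArtinLiftable
                    (mul_ne_zero h𝔤0 (pow_ne_zero ν v'.ne_bot))
                    (not_mul_pow_le₂₅ hv hvv' ν) hvv'
                    (hw_of_towerData hw𝔤) hπ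
                    (towerData_hα0 (p := p) hα0)
                    (towerData_hα𝔪 hv' hp.out hpv' hpv'2 hα𝔤 ha2 hαa)
                    (towerData_hαw (p := p) hαw)
                    (towerData_hαπ (p := p) hαπ) E hmono hE (r + 1)
                    (towerDataOffset_hdegE hf E hE hdeg)
                    (towerDataOffset_hinert h𝔤0 hv hv' hvv' hw𝔤 hp.out hpv' hpv'2 hπ hα0 hα𝔤 hαf hℓ hαℓ ha2 hαa hf hfo E hE hdeg)
                    (towerDataOffset_hcount h𝔤0 hv' hvv' hw𝔤 hp.out hdeg1 hpv' hpv'2 E hdeg) σ hσ)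
                (fun a b ↦ ⟨a.1 * b.1, a.2.mul b.2⟩)
                (fun b ↦ Ideal.absNorm (b.1 : Ideal (𝓞 K)))
                (hrule_ellipticUnitsPrincipal₂ h24iii h25 hK ιK
                    (mul_ne_zero h𝔤0 (pow_ne_zero ν v'.ne_bot))
                    (not_mul_pow_le₂₅ hv hvv' ν) hvv'
                    (hw_of_towerData hw𝔤) hπ
                    (towerData_hα0 (p := p) hα0)
                    (towerData_hα𝔪 hv' hp.out hpv' hpv'2 hα𝔤 ha2 hαa)
                    (towerData_hαw (p := p) hαw)
                    (towerData_hαπ (p := p) hαπ) E hmono (r + 1) (fun i ↦ hE (i + (r + 1)))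
                    (towerDataOffset_hdegE hf E hE hdeg) h24ii
                  Subtype.val (fun a b ↦ ⟨a.1 * b.1, a.2.mul b.2⟩) (fun _ _ ↦ rfl) (fun a ↦ a.2.1) (fun a ↦ a.2.2.1) x hx σ hσ))))) =
      Ideal.span {L} :=
  charIdeal_coinvariants_colemanImageTrace_closure_ellipticUnits_towerDataOffset_eq_span_of_eq_pow h24iii h25 h24ii hK ιK h𝔤0 hv hv' hvv' hw𝔤 hdeg1 hpv' hpv'2 hπ hα0 hα𝔤 hαw hαf hαπ hℓ hαℓ ha2 hαa hd hf hfo E hmono hE hdeg hσ₀ hq u hu γ w hγ hθ hcoh hI hud hm hN x hx σ hσ ε g hε a₁ a₂ hv₁ hn₁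
    hg₁ hg₂ hn₁π hne hn₂ hv₂ hv₂' L
    ((ne_zero_iff_colemanDeltaCoinvFun_ne_zero_of_twistMul hπ hq (intBase (v.adicCompletion K)) u hu γ
        (eq_zero_of_C_pi_mul_eq_zero_integer hπ) w hγ ε _ _ g _ L hL a₁ hv₁ hn₁).mpr
      (colemanDeltaCoinvFun_indexTraceₗ_colemanImage_ne_zero_of_sum_coordMoment_ne_zero hd hπ E hmono hE hdeg hσ₀ hq u hu γ w hγ ε hθ hcoh
        _ mm kk hεk hmom)) hL

end Capstone

end Summit.BirchSwinnertonDyer.BirchSwinnertonDyer.Theorems.PrintCf2.ColemanCoinvariantTraceEllipticUnitsTowerDataOffsetMoment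

end
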